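import Literature.Geometry.Symplectic.McleanDivisorComplementConvexFour
import Literature.Geometry.Symplectic.McleanConvexOfTubeData
import Literature.Geometry.Symplectic.SurfaceTubeData
import HarnessLib

/-!
# Proof of `mclean_divisorComplement_convex_four` (McLean 2012, Lemma 5.17, `k = 1`, dimension 4)

Discharge of the named fact `Literature.Geometry.Symplectic.mclean_divisorComplement_convex_four`
(McLean, *The growth rate of symplectic homology and affine varieties*, GAFA 22 (2012),
**Lemma 5.17** specialised to one smooth compact symplectic divisor in real dimension four):
the complement of a closed symplectic surface `b(S)` in a closed symplectic `4`-manifold, when the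
symplectic form is exact on it, carries a primitive `λ` of `s` and an exhausting function `g`
with `dg (X_λ) > 0` near infinity (a convex deformation / Liouville-domain structure at the
divisor end).

The proof is assembled from the tree, following McLean's printed proof (pp. 33–37):

* **Lemma 5.14 (`k = 1`), the symplectic tube with its Hamiltonian `U(1)`-action** —
  `Literature.Geometry.Symplectic.SurfaceTube.exists_tubeData` (`SurfaceTubeData.lean`, built in
  `SurfaceNormalData` → `SurfaceTubeRetraction` → `SurfaceTubularCharts` → `SurfaceRoundTube` →
  `SurfaceTubeCircleAction` / `SurfaceTubeScaling` → `SurfaceTubeModelForm` →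
  `SurfaceTubeMomentMap` / `SurfaceTubeRelativePoincare` → `SurfaceTubeMoserField` →
  `SurfaceTubeMoserFlow`: Whitney embedding, symplectic normal planes, round tubes, the model
  rotation, the model form `s_M` agreeing with `s` on `T_B N`, the relative Poincaré lemma and
  Moser's isotopy, McDuff–Salamon 2017, Thm. 3.4.10 / §3.2);
* **the proof of Lemma 5.17 given the tube** —
  `Literature.Geometry.Symplectic.mclean_convex_of_tubeData` (`McleanConvexOfTubeData.lean`:
  normal form `θ - dh = -(r² + 2κ)`-primitive on the punctured tube, negativity of the wrapping
  number `κ` by Stokes, and the exhausting function).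

No new definitions, no named facts; this file only performs the final assembly.

## References

* M. McLean, *The growth rate of symplectic homology and affine varieties*, GAFA 22 (2012),
  Lemmas 5.14, 5.17 (arXiv:1011.2542, pp. 33–37). [Mclean2012]
* D. McDuff, D. Salamon, *Introduction to Symplectic Topology*, 3rd ed. (2017), Thm. 3.4.10,
  §3.2. [McDuffSalamon2017]
-/

noncomputable section

open scoped Manifold ContDiff Topology
open Set Function Filter
open Literature.Geometry.Kaehler

namespace Literature.Geometry.Symplectic

/-- **McLean 2012, Lemma 5.17 (`k = 1`, dimension four)**: the named fact
`mclean_divisorComplement_convex_four` holds. [cite: Mclean2012, Lemma 5.17 with Lemma 5.14] -/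
theorem mclean_divisorComplement_convex_four_holds : mclean_divisorComplement_convex_four := by
  intro N _ _ _ _ _ _ _ s S _ _ _ _ _ _ b U hs hsc hnd hb hbs hU hex
  obtain ⟨θ, hθ, hdθ⟩ := hex
  obtain ⟨W, hWU, act, r2, V, ε₀, hact, hfree, hX0, hr2, hinv, hT4, hV, hUV, hr2U, hε₀, htube,
    hshell, hconn, hfar⟩ := SurfaceTube.exists_tubeData s hs hsc hnd b hb hbs U hU
  letI := act
  exact mclean_convex_of_tubeData s hs hsc hnd hWU θ hθ hdθ hact hfree hX0 r2 hr2 hinv hT4 hV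
    hUV hr2U hε₀ htube hshell hconn hfar

end Literature.Geometry.Symplectic
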